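import Summits.QuantumFields.BalabanUV.T4Continuum.Support.CauchySumSummableShift
import HarnessLib

/-!
# CauchySumSummableShiftSocket — the Q-calc-2 socket names of the calc-grammar lane, DISCHARGED
(cell `pub-balaban`, T4-DAG row `T4-U6.R-QCALC2°`, ruling §8 Q43 (d); names VERBATIM from `t4/calc/QCalc2Sketch.lean`)

HONEST FRAMING (cell `pub-balaban`, page 1).  Rung (B)+1 of the FINITE-VOLUME T⁴ programme — NOT infinite volume,
NOT a mass gap, NOT the Clay problem; spine PROVED 0∕9.  Elementary real analysis on the hypothesis shape
`T4CauchySum.delta` of node U6; NOT an estimate of any NE row; nothing about Bałaban's objects.  HONEST DEPENDENCY: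
continuum YM on T⁴ ⇐ BetaPertH ∧ nine spine estimates (0/9 proved); BetaPertH ⇐ (D1) ∧ (D4) ∧ CAP+tail; G-an2-4
gates asym, D1 and NE2/3/4.

CONTENT.  §1 re-declares, byte-for-byte in their bodies, the five statement shapes the calc-grammar lane typed in
`t4/calc/QCalc2Sketch.lean` (GRAMMAR v24 A-Q-calc-2 (d)): the predicates `PinnedByShift`, `SummableShift`,
`DeltaTailBound` and the closed propositions `TailBoundHolds`, `SummableDeltaOfSummableShift`.  §2 PROVES the two
closed propositions (`tailBoundHolds`, `summableDeltaOfSummableShift`) from `CauchySumSummableShift.delta_le_tail` ∕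
`summable_delta_of_shift`, and assembles node U6 on the socket (`cauchySum_of_summableShift`).  §3 non-vacuity: the
shift class contains the NON-geometric `k ↦ c∕(k+1)²` and the geometric `k ↦ c·θ^k`; the exactly-pinned injection
`inj K j = Σ_{i ∈ [j,K)} shift i` (transport factor 1) is `PinnedByShift`.
LABEL OF RECORD (T4-DAG §8 Q43 (c)): an admissible THIRD instance of node U6's `Summable δ` beside the geometric
`InjectedRate` chain (`T4CauchySum.cauchySum`) and the crossover instance (`T4Crossover.cauchySum_of_crossover`),
sufficient under reading (α′) (re-evaluation with a g-Lipschitz size bound), NOT shown sufficient under the naive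
crossover reading (β).  No importer of `T4CauchySum` changes.
-/

namespace Summit.QuantumFields.BalabanUV.T4Continuum.CauchySumSummableShiftSocket

open Finset
open Literature.MathematicalPhysics.QuantumFieldTheory.Balaban1983to89.T4CauchySum
open Summit.QuantumFields.BalabanUV.T4Continuum.CauchySumSummableShift

/-! ## §1 The socket's statement shapes (verbatim bodies of `t4/calc/QCalc2Sketch.lean`) -/

/-- HYPOTHESIS SHAPE: IR-pinned injection dominated by a scale shift, `0 ≤ inj K j ≤ Σ_{i ∈ [j, K)} shift i` for
`j ≤ K` (the Markov-model identity `disc_j(K) = Σ_{i=j}^{K-1} shift_i` with transport factor ≤ 1; calc-grammar G2).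
A predicate, never a fact. [folklore] -/
@[folklore]
def PinnedByShift (shift : ℕ → ℝ) (inj : ℕ → ℕ → ℝ) : Prop :=
  ∀ K j : ℕ, j ≤ K → 0 ≤ inj K j ∧ inj K j ≤ ∑ i ∈ Ico j K, shift i

/-- HYPOTHESIS SHAPE: a summable, antitone, nonnegative synchronised scale shift (e.g. `shift k = c∕(k+1)^p`, `p > 1`;
no geometric rate).  A predicate, never a fact. [folklore] -/
@[folklore]
def SummableShift (shift : ℕ → ℝ) : Prop :=
  (∀ k, 0 ≤ shift k) ∧ Antitone shift ∧ Summable shift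

/-- STATEMENT SHAPE (the LAST-STEP RULE as an inequality): split the antidiagonal at `n = K∕2`; recent scales
contribute `≤ shift (K∕2) · ρ∕(1−ρ)²`, old scales `≤ (Σ' shift) · ρ^{K∕2}∕(1−ρ)`. [folklore] -/
@[folklore]
def DeltaTailBound (E ρ : ℝ) (shift : ℕ → ℝ) (inj : ℕ → ℕ → ℝ) : Prop :=
  ∀ K : ℕ, delta E ρ inj K ≤
    E * (shift (K / 2) * (ρ / (1 - ρ) ^ 2) + (∑' i, shift i) * (ρ ^ (K / 2) / (1 - ρ)))

/-- Q-calc-2, part (i) (closed proposition): the tail bound holds for pinned-by-shift injections. PROVED below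
(`tailBoundHolds`). [folklore] -/
@[folklore]
def TailBoundHolds : Prop :=
  ∀ (E ρ : ℝ) (shift : ℕ → ℝ) (inj : ℕ → ℕ → ℝ),
    0 ≤ E → 0 ≤ ρ → ρ < 1 → SummableShift shift → PinnedByShift shift inj → DeltaTailBound E ρ shift inj

/-- Q-calc-2, part (ii) (closed proposition): `Σ_K δ_K < ∞` WITHOUT a geometric injected rate — the hypothesis node
U6 can carry instead of `InjectedRate C c θ inj`. PROVED below (`summableDeltaOfSummableShift`). [folklore] -/
@[folklore]
def SummableDeltaOfSummableShift : Prop :=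
  ∀ (E ρ : ℝ) (shift : ℕ → ℝ) (inj : ℕ → ℕ → ℝ),
    0 ≤ E → 0 ≤ ρ → ρ < 1 → SummableShift shift → PinnedByShift shift inj → Summable (delta E ρ inj)

/-! ## §2 The closed propositions PROVED; node U6 assembled on the socket -/

/-- **`TailBoundHolds` is a theorem** (by `CauchySumSummableShift.delta_le_tail`). [folklore] -/
theorem tailBoundHolds : TailBoundHolds :=
  fun _E _ρ _shift _inj hE hρ hρ1 hs hp K => delta_le_tail hE hρ hρ1 hs.1 hs.2.1 hs.2.2 hp K

/-- **`SummableDeltaOfSummableShift` is a theorem** (by `CauchySumSummableShift.summable_delta_of_shift`).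
[folklore] -/
theorem summableDeltaOfSummableShift : SummableDeltaOfSummableShift :=
  fun _E _ρ _shift _inj hE hρ hρ1 hs hp => summable_delta_of_shift hE hρ hρ1 hs.1 hs.2.1 hs.2.2 hp

/-- **Node U6 assembled on the socket**: `SummableShift shift`, `PinnedByShift shift inj`, `0 ≤ E`, `0 ≤ ρ < 1` and
node U5 as `MatchingModConstants vol l₀ (delta E ρ inj) Z` give summable `δ`, the `2·vol·δ_K` step bound, Cauchy
generating functions and uniform convergence on the closed l₀-ball — the shape node U0 consumes
(`CauchySumSummableShift.cauchySum_of_shift`).  CONDITIONAL over hypothesis shapes; admissible under reading (α′)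
only. [folklore] -/
theorem cauchySum_of_summableShift {ρ E vol l₀ : ℝ} {shift : ℕ → ℝ} {inj : ℕ → ℕ → ℝ} {Z : ℕ → ℝ → ℝ}
    (hE : 0 ≤ E) (hρ : 0 ≤ ρ) (hρ1 : ρ < 1) (hs : SummableShift shift) (hp : PinnedByShift shift inj)
    (hl₀ : 0 ≤ l₀) (hU5 : MatchingModConstants vol l₀ (delta E ρ inj) Z) :
    Summable (delta E ρ inj) ∧
    (∀ K : ℕ, ∀ t : ℝ, |t| ≤ l₀ → |genFun Z (K + 1) t - genFun Z K t| ≤ 2 * (vol * delta E ρ inj K)) ∧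
    (∀ t : ℝ, |t| ≤ l₀ → CauchySeq fun K => genFun Z K t) ∧
    TendstoUniformlyOn (fun K t => genFun Z K t) (genFunLim Z) Filter.atTop {t | |t| ≤ l₀} :=
  cauchySum_of_shift hE hρ hρ1 hs.1 hs.2.1 hs.2.2 hp hl₀ hU5

/-! ## §3 Non-vacuity of the socket's hypothesis classes -/

/-- The NON-geometric shift `k ↦ c∕(k+1)²` (`c ≥ 0`) is a `SummableShift`. [folklore] -/
theorem summableShift_inv_sq {c : ℝ} (hc : 0 ≤ c) : SummableShift (fun k : ℕ => c / ((k : ℝ) + 1) ^ 2) :=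
  shift_inv_sq_admissible hc

/-- The geometric shift `k ↦ c·θ^k` (`c ≥ 0`, `0 ≤ θ < 1`) is a `SummableShift` (so the socket CONTAINS the geometric
class; it does not replace it). [folklore] -/
theorem summableShift_geometric {c θ : ℝ} (hc : 0 ≤ c) (hθ : 0 ≤ θ) (hθ1 : θ < 1) :
    SummableShift (fun k : ℕ => c * θ ^ k) := by
  refine ⟨fun k => mul_nonneg hc (pow_nonneg hθ k), fun k m hkm => ?_, ?_⟩
  · exact mul_le_mul_of_nonneg_left (pow_le_pow_of_le_one hθ hθ1.le hkm) hc
  · exact (summable_geometric_of_lt_one hθ hθ1).mul_left c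

/-- The EXACTLY pinned injection `inj K j = Σ_{i ∈ [j, K)} shift i` (transport factor 1) is `PinnedByShift` for a
nonnegative shift. [folklore] -/
theorem pinnedByShift_sum {shift : ℕ → ℝ} (h0 : ∀ k, 0 ≤ shift k) :
    PinnedByShift shift (fun K j => ∑ i ∈ Ico j K, shift i) :=
  fun _K _j _ => ⟨Finset.sum_nonneg fun i _ => h0 i, le_rfl⟩

/-- Hence, CONCRETELY: with `shift k = c∕(k+1)²` and the exactly pinned injection, `Σ_K δ_K < ∞` for every `0 ≤ E`,
`0 ≤ ρ < 1` — a summable `δ` at node U6 with NO geometric source rate anywhere. [folklore] -/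
theorem summable_delta_inv_sq {c E ρ : ℝ} (hc : 0 ≤ c) (hE : 0 ≤ E) (hρ : 0 ≤ ρ) (hρ1 : ρ < 1) :
    Summable (delta E ρ (fun K j => ∑ i ∈ Ico j K, c / ((i : ℝ) + 1) ^ 2)) :=
  summableDeltaOfSummableShift E ρ _ _ hE hρ hρ1 (summableShift_inv_sq hc)
    (pinnedByShift_sum (summableShift_inv_sq hc).1)

end Summit.QuantumFields.BalabanUV.T4Continuum.CauchySumSummableShiftSocket
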